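import Literature.NumberTheory.LFunctions.SimpleZerosProofs
import HarnessLib

/-!
# Simple zeros of `ζ`: the Cheer–Goldston / Montgomery–Taylor multiplicity bound, proved

Topic `Literature/NumberTheory/LFunctions`. Proofs only (no definitions, no named facts).
Companion of `SimpleZeros.lean` and `SimpleZerosProofs.lean`: DISCHARGE of the named fact
`Literature.NumberTheory.LFunctions.CheerGoldston1993_sum_multiplicity` — assuming RH, for every
`ε > 0` and all large `T`, `∑'_{ρ : 0 < Im ρ ≤ T} m(ρ)² ≤ (1.3275 + ε) N(T)` (Cheer–Goldston 1993, as
quoted by Bui–Heath-Brown 2013, §1; sharper than Montgomery's `4/3`,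
`Montgomery1973_sum_sq_multiplicity_holds`) — from two theorems of the tree: Montgomery's theorem
on the form factor `F(α, T)` (`montgomery_pair_correlation_restricted_holds`, Montgomery 1973) and
the Riemann–von Mangoldt formula (through `ZeroGapsProofs.eventually_mul_log_le`).

## The printed argument (Cheer–Goldston 1993, §2 "Montgomery and Taylor's method")

With `L = log T/2π`, `N*(T) := ∑_{0<γ≤T} m_ρ` (zeros counted with multiplicity, so that
`N*(T) = ∑'_ρ m(ρ)²` over the distinct zeros) and Montgomery's
`F(α) = (TL)⁻¹ ∑_{0<γ,γ'≤T} T^{iα(γ−γ')} w(γ−γ')`, `w(u) = 4/(4+u²)`: for an even kernel `r ≥ 0`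
whose Fourier transform `r̂` is supported in `[−1, 1]`,
`r(0) N*(T) ≤ ∑_{γ,γ'} r((γ−γ')L) w(γ−γ') = TL ∫ r̂(α) F(α) dα = (r̂(0) + 2∫_0^1 α r̂(α) dα + o(1)) TL`
((8)–(10)), by Montgomery's theorem `F(α) = (1+o(1)) T^{−2α} log T + α + o(1)` (uniformly on
`[0, 1 − δ]`). Writing `r̂ = h * h̃` with `h` supported in `[−1/2, 1/2]` the optimum is
`h(s) = cos(√2 s)`, giving `N*(T) ≤ (1/2 + 2^{−1/2} cot(2^{−1/2}) + o(1)) TL = (1.3274993… + o(1)) TL`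
((11)–(12)); §3 of the paper improves this to `1.32724667` by a combinatorial argument. Either
constant implies the rounded `1.3275` recorded in the fact, and we prove the Montgomery–Taylor
bound (§2) only.

## The proof written here

* `SimpleZerosProofs.finsum_sq_order_le_card_diag` (imported) —
  `∑'_ρ m(ρ)² ≤ #{(n,n') : n,n' < N(T), γ_n = γ_{n'}}` (the diagonal `γ = γ'` of the pair sum).
* `CheerGoldston.integral_integral_sum_cos` — the Fourier square: for continuous `h`,
  `∫∫ h(s)h(t) ∑_p c_p cos((s−t)θ_p) = ∑_p c_p ((∫ h cos θ_p·)² + (∫ h sin θ_p·)²)`; hence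
  (`CheerGoldston.mul_card_diag_le_integral_integral`) the double integral
  `Q = ∫_{−a}^{a}∫_{−a}^{a} h(s)h(t) F(s−t, T) dt ds` is at least `(2π/(T log T)) (∫h)² #{γ_n = γ_{n'}}`
  — this is (8)–(9) with `r = |ȟ|²`, `r̂ = h * h̃`, written without Fourier transforms.
* `CheerGoldston.integral_integral_le_of_formFactor_bound` — the upper bound (9)–(10):
  Montgomery's theorem gives `F(v, T) ≤ (1+ε) λe^{−2λ|v|} + |v| + ε` for `|v| ≤ 2a = 1 − δ`
  (`λ = log T`), and with `h ≥ 0`, `h(t) ≤ h(s) + L|s−t|`, `∫ λe^{−2λ|s−t|} dt ≤ 1`,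
  `∫ |s−t| λe^{−2λ|s−t|} dt ≤ 1/(2λ)`:
  `Q ≤ (1+ε)(∫h² + L∫h/(2λ)) + ∫_s h(s) ∫_t h(t)|s−t| + ε(∫h)²`.
* The kernel: `h(s) = 1 − s² + s⁴/6` (the Taylor polynomial of `cos(√2 s)`) on `[−a, a]`,
  `a = 1/2 − 10⁻⁷` (to stay inside the uniform range `|α| ≤ 1 − δ` of the tree's restricted
  form of Montgomery's theorem). All four integrals are rational (`CheerGoldston.integral_kernelH`,
  `…_sq`, `…_mul_abs`, `…_mul_moment`) and
  `V = (∫h² + ∫∫ h(s)h(t)|s−t|)/(∫h)² = 1.32749943… < 1.3275`, checked by `norm_num`.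
* The assembly `CheerGoldston1993_sum_multiplicity_holds` (with `ε = 10⁻⁷` in Montgomery's theorem,
  `T log T/(2π) ≤ (1 + 10⁻⁷) N(T)` from `ZeroGapsProofs.eventually_mul_log_le`, and `log T ≥ 10⁷`)
  in fact gives `∑' m(ρ)² ≤ 1.3275 N(T)` for all large `T`.
* Consequence (`BuiHeathbrown2013_simple_zeros.distinct_zeros`, proved): with the Cheer–Goldston
  input discharged, Bui–Heath-Brown's Corollary 1 (`BuiHeathbrown2013_distinct_zeros`,
  `κ_d ≥ 0.84665` on RH) follows from their Theorem 1 (`BuiHeathbrown2013_simple_zeros`,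
  `κ* ≥ 19/27` on RH) alone, by the printed deduction
  `BuiHeathbrown2013_distinct_zeros_of_simple_zeros` of `SimpleZeros.lean`.

## References

* A. Y. Cheer, D. A. Goldston, *Simple zeros of the Riemann zeta-function*, Proc. Amer. Math.
  Soc. 118 (1993), 365–372: §2, eqs. (1)–(12) (pp. 366–368); §3, p. 371; §4, (25)
  (held scan `paper:doi-10-2307-2160310`). [key `CheerGoldston1993`]
* H. L. Montgomery, *The pair correlation of zeros of the zeta function*, Proc. Sympos. Pure Math.
  24 (1973), 181–193, Theorem. [key `Montgomery1973`]
* H. M. Bui, D. R. Heath-Brown, *On simple zeros of the Riemann zeta-function*, Bull. London Math.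
  Soc. 45 (2013), 953–961, §1 (the quotation of the constant `1.3275`).
-/

noncomputable section

open Real Filter Set MeasureTheory intervalIntegral
open scoped Topology

namespace Literature.NumberTheory.LFunctions

namespace CheerGoldston

/-! ## The kernel `λ e^{-2λ|v|}` of Montgomery's theorem: two elementary integrals -/

/-- `∫_0^c λ e^{-2λv} dv = (1 - e^{-2λc})/2`. [folklore] -/
theorem integral_mul_exp_neg (lam c : ℝ) :
    ∫ v in (0 : ℝ)..c, lam * Real.exp (-2 * lam * v) = (1 - Real.exp (-2 * lam * c)) / 2 := by
  have hderiv : ∀ v ∈ uIcc (0 : ℝ) c,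
      HasDerivAt (fun v ↦ -Real.exp (-2 * lam * v) / 2) (lam * Real.exp (-2 * lam * v)) v := by
    intro v _
    have h1 : HasDerivAt (fun v ↦ -2 * lam * v) (-2 * lam) v := by
      simpa using (hasDerivAt_id v).const_mul (-2 * lam)
    exact ((h1.exp.fun_neg).div_const 2).congr_deriv (by ring)
  rw [intervalIntegral.integral_eq_sub_of_hasDerivAt hderiv ((by fun_prop : Continuous fun v ↦
    lam * Real.exp (-2 * lam * v)).intervalIntegrable _ _)]
  simp only [mul_zero, Real.exp_zero]
  ring

/-- `∫_0^c v λ e^{-2λv} dv = 1/(4λ) - (c/2 + 1/(4λ)) e^{-2λc} ≤ 1/(4λ)` for `λ > 0`, `c ≥ 0`.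
[folklore] -/
theorem integral_id_mul_exp_neg_le {lam c : ℝ} (hlam : 0 < lam) (hc : 0 ≤ c) :
    ∫ v in (0 : ℝ)..c, v * (lam * Real.exp (-2 * lam * v)) ≤ 1 / (4 * lam) := by
  have hderiv : ∀ v ∈ uIcc (0 : ℝ) c,
      HasDerivAt (fun v ↦ -((v / 2 + 1 / (4 * lam)) * Real.exp (-2 * lam * v)))
        (v * (lam * Real.exp (-2 * lam * v))) v := by
    intro v _
    have h1 : HasDerivAt (fun v ↦ -2 * lam * v) (-2 * lam) v := by
      simpa using (hasDerivAt_id v).const_mul (-2 * lam)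
    have h2 : HasDerivAt (fun v ↦ v / 2 + 1 / (4 * lam)) (1 / 2) v := by
      simpa using ((hasDerivAt_id v).div_const 2).add_const (1 / (4 * lam))
    exact ((h2.mul h1.exp).fun_neg).congr_deriv (by field_simp; ring)
  rw [intervalIntegral.integral_eq_sub_of_hasDerivAt hderiv ((by fun_prop : Continuous fun v ↦
    v * (lam * Real.exp (-2 * lam * v))).intervalIntegrable _ _)]
  have hpos : 0 < Real.exp (-2 * lam * c) := Real.exp_pos _
  have h4 : 0 < 4 * lam := by positivity
  have : 0 ≤ (c / 2 + 1 / (4 * lam)) * Real.exp (-2 * lam * c) := by positivity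
  simp only [mul_zero, Real.exp_zero, mul_one, zero_div, zero_add]
  linarith

/-- Reduction of `∫_{-a}^{a} f(|s - t|) dt` (`|s| ≤ a`) to the two one-sided integrals
`∫_0^{a-s} f + ∫_0^{a+s} f`. [folklore] -/
theorem integral_comp_abs_sub {f : ℝ → ℝ} (hf : Continuous f) {a s : ℝ} (h₁ : -a ≤ s) (h₂ : s ≤ a) :
    ∫ t in (-a)..a, f |s - t| = (∫ v in (0 : ℝ)..(a - s), f v) + ∫ v in (0 : ℝ)..(a + s), f v := by
  have hc : Continuous fun v ↦ f |v| := hf.comp continuous_abs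
  have e1 : ∫ t in (-a)..a, f |s - t| = ∫ v in (s - a)..(s + a), f |v| := by
    have := intervalIntegral.integral_comp_sub_left (f := fun v ↦ f |v|) (a := -a) (b := a) s
    simpa only [sub_neg_eq_add] using this
  have e2 : ∫ v in (s - a)..(s + a), f |v| =
      (∫ v in (s - a)..0, f |v|) + ∫ v in (0 : ℝ)..(s + a), f |v| :=
    (intervalIntegral.integral_add_adjacent_intervals (hc.intervalIntegrable _ _)
      (hc.intervalIntegrable _ _)).symm
  have e3 : ∫ v in (s - a)..0, f |v| = ∫ v in (0 : ℝ)..(a - s), f v := by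
    have := intervalIntegral.integral_comp_neg (a := 0) (b := a - s) (f := fun v ↦ f |v|)
    simp only [abs_neg, neg_zero, neg_sub] at this
    rw [← this]
    refine intervalIntegral.integral_congr fun v hv ↦ ?_
    rw [uIcc_of_le (by linarith)] at hv
    simp [abs_of_nonneg hv.1]
  have e4 : ∫ v in (0 : ℝ)..(s + a), f |v| = ∫ v in (0 : ℝ)..(a + s), f v := by
    rw [add_comm s a]
    refine intervalIntegral.integral_congr fun v hv ↦ ?_
    rw [uIcc_of_le (by linarith)] at hv
    simp [abs_of_nonneg hv.1]
  rw [e1, e2, e3, e4]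

/-- `∫_{-a}^{a} λ e^{-2λ|s-t|} dt ≤ 1` for `|s| ≤ a` (any real `λ`). [folklore] -/
theorem integral_kernel_le_one {lam a s : ℝ} (h₁ : -a ≤ s) (h₂ : s ≤ a) :
    ∫ t in (-a)..a, lam * Real.exp (-2 * lam * |s - t|) ≤ 1 := by
  have := integral_comp_abs_sub (f := fun v ↦ lam * Real.exp (-2 * lam * v)) (by fun_prop) h₁ h₂
  rw [this, integral_mul_exp_neg, integral_mul_exp_neg]
  have := Real.exp_pos (-2 * lam * (a - s))
  have := Real.exp_pos (-2 * lam * (a + s))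
  linarith

/-- `∫_{-a}^{a} |s-t| λ e^{-2λ|s-t|} dt ≤ 1/(2λ)` for `|s| ≤ a`, `λ > 0`. [folklore] -/
theorem integral_abs_mul_kernel_le {lam a s : ℝ} (hlam : 0 < lam) (h₁ : -a ≤ s) (h₂ : s ≤ a) :
    ∫ t in (-a)..a, |s - t| * (lam * Real.exp (-2 * lam * |s - t|)) ≤ 1 / (2 * lam) := by
  have := integral_comp_abs_sub (f := fun v ↦ v * (lam * Real.exp (-2 * lam * v)))
    (by fun_prop) h₁ h₂
  rw [this]
  have i1 := integral_id_mul_exp_neg_le hlam (c := a - s) (by linarith)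
  have i2 := integral_id_mul_exp_neg_le hlam (c := a + s) (by linarith)
  have : 1 / (4 * lam) + 1 / (4 * lam) = 1 / (2 * lam) := by field_simp; norm_num
  linarith

/-! ## Positivity: the double integral against a cosine sum is a sum of squares -/

/-- **The Fourier square.** For continuous `h` and reals `c_i`, `θ_i`:
`∫_a^b ∫_a^b h(s) h(t) ∑_i c_i cos((s − t)θ_i) dt ds = ∑_i c_i ((∫_a^b h(s) cos(sθ_i) ds)² + (∫_a^b h(s) sin(sθ_i) ds)²)`
(expand `cos(x − y) = cos x cos y + sin x sin y`). With `c_i ≥ 0` every term is non-negative: this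
is the finite form of `∑_{γ,γ'} r((γ−γ')L) w(γ−γ') = TL ∫ r̂ F` with `r = |ȟ|² ≥ 0`
(Cheer–Goldston 1993, (8) and (25)). [cite: CheerGoldston1993, §2 (8)] -/
theorem integral_integral_sum_cos {ι : Type*} (S : Finset ι) (c θ : ι → ℝ) {h : ℝ → ℝ}
    (hh : Continuous h) (a b : ℝ) :
    ∫ s in a..b, (∫ t in a..b, h s * h t * ∑ i ∈ S, c i * Real.cos ((s - t) * θ i)) =
      ∑ i ∈ S, c i * ((∫ s in a..b, h s * Real.cos (s * θ i)) ^ 2 +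
        (∫ s in a..b, h s * Real.sin (s * θ i)) ^ 2) := by
  have hI : ∀ {g : ℝ → ℝ}, Continuous g → IntervalIntegrable g volume a b :=
    fun hg ↦ hg.intervalIntegrable _ _
  set C : ι → ℝ := fun i ↦ ∫ s in a..b, h s * Real.cos (s * θ i) with hC
  set Sn : ι → ℝ := fun i ↦ ∫ s in a..b, h s * Real.sin (s * θ i) with hSn
  -- pointwise expansion of the integrand
  have hpt : ∀ s t, h s * h t * ∑ i ∈ S, c i * Real.cos ((s - t) * θ i) =
      ∑ i ∈ S, (c i * (h s * Real.cos (s * θ i)) * (h t * Real.cos (t * θ i)) +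
        c i * (h s * Real.sin (s * θ i)) * (h t * Real.sin (t * θ i))) := by
    intro s t
    rw [Finset.mul_sum]
    refine Finset.sum_congr rfl fun i _ ↦ ?_
    rw [show (s - t) * θ i = s * θ i - t * θ i by ring, Real.cos_sub]
    ring
  -- the inner integral
  have hin : ∀ s, ∫ t in a..b, h s * h t * ∑ i ∈ S, c i * Real.cos ((s - t) * θ i) =
      ∑ i ∈ S, (c i * (h s * Real.cos (s * θ i)) * C i +
        c i * (h s * Real.sin (s * θ i)) * Sn i) := by
    intro s
    simp_rw [hpt]
    rw [intervalIntegral.integral_finsetSum fun i _ ↦ hI (by fun_prop)]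
    refine Finset.sum_congr rfl fun i _ ↦ ?_
    rw [intervalIntegral.integral_add (hI (by fun_prop)) (hI (by fun_prop)),
      intervalIntegral.integral_const_mul, intervalIntegral.integral_const_mul]
  simp_rw [hin]
  rw [intervalIntegral.integral_finsetSum fun i _ ↦ hI (by fun_prop)]
  refine Finset.sum_congr rfl fun i _ ↦ ?_
  rw [intervalIntegral.integral_add (hI (by fun_prop)) (hI (by fun_prop)),
    intervalIntegral.integral_mul_const, intervalIntegral.integral_mul_const,
    intervalIntegral.integral_const_mul, intervalIntegral.integral_const_mul]
  simp only [hC, hSn]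
  ring

/-- Montgomery's form factor as a cosine sum: `F(α, T) = ∑_p c_p cos(α θ_p)` over the pairs
`p = (n, n')`, `n, n' < N(T)`, with `c_p = (2π/(T log T)) w(γ_n − γ_{n'}) > 0` and
`θ_p = log T · (γ_n − γ_{n'})`. [cite: Montgomery1973, §1 (1)] -/
theorem montgomeryFormFactor_eq_sum_cos (α T : ℝ) :
    montgomeryFormFactor α T = ∑ p ∈ zeroIndexSet T ×ˢ zeroIndexSet T,
      (2 * π / (T * Real.log T) * montgomeryWeight (zetaOrdinate p.1 - zetaOrdinate p.2)) *
        Real.cos (α * (Real.log T * (zetaOrdinate p.1 - zetaOrdinate p.2))) := by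
  unfold montgomeryFormFactor
  rw [Finset.mul_sum]
  refine Finset.sum_congr rfl fun p _ ↦ ?_
  rw [← mul_assoc α]
  ring

/-- `F(·, T)` is continuous (a trigonometric polynomial). [folklore] -/
theorem continuous_montgomeryFormFactor (T : ℝ) : Continuous fun α ↦ montgomeryFormFactor α T := by
  simp_rw [montgomeryFormFactor_eq_sum_cos]
  fun_prop

/-- **The diagonal lower bound** (Cheer–Goldston 1993, (9) → (10): "`r(0) N*(T) ≤ …`", the sum
over the pairs `γ ≠ γ'` being non-negative since `r ≥ 0`). In the double-integral form: for
continuous `h` and `T > 1`,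
`(2π/(T log T)) (∫ h)² · #{(n, n') : γ_n = γ_{n'}} ≤ ∫∫ h(s) h(t) F(s − t, T) dt ds`,
because the right side is `∑_p c_p Φ(θ_p)` with `Φ ≥ 0` (`integral_integral_sum_cos`), and the
pairs with `γ_n = γ_{n'}` contribute `c_p Φ(0) = (2π/(T log T)) · w(0) · (∫ h)²`, `w(0) = 1`.
[cite: CheerGoldston1993, §2 (9)–(10)] -/
theorem mul_card_diag_le_integral_integral {T : ℝ} (hT : 1 < T) {h : ℝ → ℝ} (hh : Continuous h)
    (a : ℝ) :
    2 * π / (T * Real.log T) * (∫ s in (-a)..a, h s) ^ 2 *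
        (((zeroIndexSet T ×ˢ zeroIndexSet T).filter
          (fun p ↦ zetaOrdinate p.1 = zetaOrdinate p.2)).card : ℝ) ≤
      ∫ s in (-a)..a, ∫ t in (-a)..a, h s * h t * montgomeryFormFactor (s - t) T := by
  have hlog : 0 < Real.log T := Real.log_pos hT
  have hc : 0 < 2 * π / (T * Real.log T) := by
    have : 0 < T := by linarith
    positivity
  simp_rw [montgomeryFormFactor_eq_sum_cos]
  rw [integral_integral_sum_cos _ _ _ hh]
  set P := zeroIndexSet T ×ˢ zeroIndexSet T with hP
  set D := P.filter (fun p ↦ zetaOrdinate p.1 = zetaOrdinate p.2) with hD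
  calc 2 * π / (T * Real.log T) * (∫ s in (-a)..a, h s) ^ 2 * (D.card : ℝ)
      = ∑ p ∈ D, 2 * π / (T * Real.log T) * (∫ s in (-a)..a, h s) ^ 2 := by
        rw [Finset.sum_const, nsmul_eq_mul]; ring
    _ = ∑ p ∈ D, (2 * π / (T * Real.log T) *
          montgomeryWeight (zetaOrdinate p.1 - zetaOrdinate p.2)) *
          ((∫ s in (-a)..a, h s * Real.cos (s * (Real.log T * (zetaOrdinate p.1 - zetaOrdinate p.2)))) ^ 2 +
            (∫ s in (-a)..a, h s * Real.sin (s * (Real.log T * (zetaOrdinate p.1 - zetaOrdinate p.2)))) ^ 2) := by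
        refine Finset.sum_congr rfl fun p hp ↦ ?_
        have h0 : zetaOrdinate p.1 - zetaOrdinate p.2 = 0 := sub_eq_zero.2 (Finset.mem_filter.1 hp).2
        simp [h0, SimpleZerosProofs.montgomeryWeight_zero]
    _ ≤ _ := by
        refine Finset.sum_le_sum_of_subset_of_nonneg (Finset.filter_subset _ _) fun p _ _ ↦ ?_
        exact mul_nonneg (mul_nonneg hc.le (montgomeryWeight_pos _).le)
          (add_nonneg (sq_nonneg _) (sq_nonneg _))

/-! ## The upper bound: Montgomery's theorem integrated against `h(s) h(t)` -/

/-- **The integrated form of Montgomery's theorem** (Cheer–Goldston 1993, (9)–(10): the right-hand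
side `(r̂(0) + 2∫_0^1 α r̂(α) dα + o(1)) TL` for `r̂ = h * h̃`). Abstract version: let `h ≥ 0` be
continuous on `[-a, a]` with `h(t) ≤ h(s) + L|s − t|` there, and let `F` be continuous with
`F(v) ≤ (1 + ε) λe^{−2λ|v|} + |v| + ε` for `|v| ≤ 2a` (which is what Montgomery's theorem gives
for `F(·, T)`, `λ = log T`, `2a ≤ 1 − δ`). Then
`∫∫ h(s)h(t)F(s−t) ≤ (1+ε)(∫h² + L∫h/(2λ)) + ∫_s h(s)∫_t h(t)|s−t| + ε(∫h)²`: pointwise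
`h(s)h(t)F ≤ (1+ε)h(s)(h(s) + L|s−t|)λe^{−2λ|s−t|} + h(s)h(t)|s−t| + εh(s)h(t)`, then
`∫_t λe^{−2λ|s−t|} dt ≤ 1` and `∫_t |s−t| λe^{−2λ|s−t|} dt ≤ 1/(2λ)`.
[cite: CheerGoldston1993, §2 (9)–(10)] -/
theorem integral_integral_le_of_formFactor_bound {a lam ε L : ℝ} (ha : 0 < a) (hlam : 0 < lam)
    (hε : 0 ≤ ε) (hL : 0 ≤ L) {h F : ℝ → ℝ} (hh : Continuous h) (hF : Continuous F)
    (h0 : ∀ s ∈ Icc (-a) a, 0 ≤ h s)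
    (hLip : ∀ s ∈ Icc (-a) a, ∀ t ∈ Icc (-a) a, h t ≤ h s + L * |s - t|)
    (hFle : ∀ v, |v| ≤ 2 * a → F v ≤ (1 + ε) * (lam * Real.exp (-2 * lam * |v|)) + |v| + ε) :
    ∫ s in (-a)..a, ∫ t in (-a)..a, h s * h t * F (s - t) ≤
      (1 + ε) * ((∫ s in (-a)..a, h s ^ 2) + L * (∫ s in (-a)..a, h s) / (2 * lam)) +
        (∫ s in (-a)..a, h s * ∫ t in (-a)..a, h t * |s - t|) + ε * (∫ s in (-a)..a, h s) ^ 2 := by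
  have haa : -a ≤ a := by linarith
  have hI : ∀ {g : ℝ → ℝ}, Continuous g → IntervalIntegrable g volume (-a) a :=
    fun hg ↦ hg.intervalIntegrable _ _
  set I := ∫ s in (-a)..a, h s with hIdef
  set P₁ : ℝ → ℝ := fun s ↦ ∫ t in (-a)..a, h t * |s - t| with hP₁
  have hP₁c : Continuous P₁ := by
    simp only [hP₁]
    exact intervalIntegral.continuous_parametric_intervalIntegral_of_continuous'
      (by show Continuous fun p : ℝ × ℝ ↦ h p.2 * |p.1 - p.2|; fun_prop) _ _
  -- the inner integral, bounded for each `s ∈ [-a, a]`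
  have hinner : ∀ s ∈ Icc (-a) a, ∫ t in (-a)..a, h s * h t * F (s - t) ≤
      (1 + ε) * h s ^ 2 + (1 + ε) * L / (2 * lam) * h s + h s * P₁ s + ε * I * h s := by
    intro s hs
    have hs0 := h0 s hs
    calc ∫ t in (-a)..a, h s * h t * F (s - t)
        ≤ ∫ t in (-a)..a, ((1 + ε) * h s ^ 2 * (lam * Real.exp (-2 * lam * |s - t|)) +
            (1 + ε) * L * h s * (|s - t| * (lam * Real.exp (-2 * lam * |s - t|))) +
            h s * (h t * |s - t|) + ε * h s * h t) := by
          refine intervalIntegral.integral_mono_on haa (hI (by fun_prop)) (hI (by fun_prop))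
            fun t ht ↦ ?_
          have hst : |s - t| ≤ 2 * a := by
            rw [abs_le]; constructor <;> linarith [hs.1, hs.2, ht.1, ht.2]
          have hF1 := hFle (s - t) hst
          have ht0 := h0 t ht
          have hK0 : 0 ≤ lam * Real.exp (-2 * lam * |s - t|) := by positivity
          have step1 : h s * h t * F (s - t) ≤
              h s * h t * ((1 + ε) * (lam * Real.exp (-2 * lam * |s - t|)) + |s - t| + ε) :=
            mul_le_mul_of_nonneg_left hF1 (mul_nonneg hs0 ht0)
          have step2 : (1 + ε) * h s * (h t * (lam * Real.exp (-2 * lam * |s - t|))) ≤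
              (1 + ε) * h s * ((h s + L * |s - t|) * (lam * Real.exp (-2 * lam * |s - t|))) :=
            mul_le_mul_of_nonneg_left (mul_le_mul_of_nonneg_right (hLip s hs t ht) hK0)
              (mul_nonneg (by linarith) hs0)
          linarith
      _ = (∫ t in (-a)..a, (1 + ε) * h s ^ 2 * (lam * Real.exp (-2 * lam * |s - t|))) +
            (∫ t in (-a)..a, (1 + ε) * L * h s * (|s - t| * (lam * Real.exp (-2 * lam * |s - t|)))) +
            (∫ t in (-a)..a, h s * (h t * |s - t|)) + ∫ t in (-a)..a, ε * h s * h t := by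
          rw [intervalIntegral.integral_add ?_ ?_, intervalIntegral.integral_add ?_ ?_,
            intervalIntegral.integral_add ?_ ?_]
          all_goals exact hI (by fun_prop)
      _ ≤ (1 + ε) * h s ^ 2 * 1 + (1 + ε) * L * h s * (1 / (2 * lam)) + h s * P₁ s + ε * h s * I := by
          have e1 : ∫ t in (-a)..a, (1 + ε) * h s ^ 2 * (lam * Real.exp (-2 * lam * |s - t|)) =
              (1 + ε) * h s ^ 2 * ∫ t in (-a)..a, lam * Real.exp (-2 * lam * |s - t|) :=
            intervalIntegral.integral_const_mul _ _
          have e2 : ∫ t in (-a)..a, (1 + ε) * L * h s * (|s - t| * (lam * Real.exp (-2 * lam * |s - t|))) =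
              (1 + ε) * L * h s * ∫ t in (-a)..a, |s - t| * (lam * Real.exp (-2 * lam * |s - t|)) :=
            intervalIntegral.integral_const_mul _ _
          have e3 : ∫ t in (-a)..a, h s * (h t * |s - t|) = h s * P₁ s :=
            intervalIntegral.integral_const_mul _ _
          have e4 : ∫ t in (-a)..a, ε * h s * h t = ε * h s * I :=
            intervalIntegral.integral_const_mul _ _
          rw [e1, e2, e3, e4]
          have k1 := integral_kernel_le_one (lam := lam) hs.1 hs.2
          have k2 := integral_abs_mul_kernel_le hlam hs.1 hs.2
          have c1 : 0 ≤ (1 + ε) * h s ^ 2 := by positivity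
          have c2 : 0 ≤ (1 + ε) * L * h s := by positivity
          nlinarith [mul_le_mul_of_nonneg_left k1 c1, mul_le_mul_of_nonneg_left k2 c2]
      _ = _ := by ring
  -- the outer integral
  calc ∫ s in (-a)..a, ∫ t in (-a)..a, h s * h t * F (s - t)
      ≤ ∫ s in (-a)..a, ((1 + ε) * h s ^ 2 + (1 + ε) * L / (2 * lam) * h s + h s * P₁ s +
          ε * I * h s) := by
        refine intervalIntegral.integral_mono_on haa ?_ (hI (by fun_prop)) hinner
        exact hI (intervalIntegral.continuous_parametric_intervalIntegral_of_continuous'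
          (by show Continuous fun p : ℝ × ℝ ↦ h p.1 * h p.2 * F (p.1 - p.2); fun_prop) _ _)
    _ = (∫ s in (-a)..a, (1 + ε) * h s ^ 2) + (∫ s in (-a)..a, (1 + ε) * L / (2 * lam) * h s) +
          (∫ s in (-a)..a, h s * P₁ s) + ∫ s in (-a)..a, ε * I * h s := by
        rw [intervalIntegral.integral_add ?_ ?_, intervalIntegral.integral_add ?_ ?_,
          intervalIntegral.integral_add ?_ ?_]
        all_goals exact hI (by fun_prop)
    _ = (1 + ε) * (∫ s in (-a)..a, h s ^ 2) + (1 + ε) * L / (2 * lam) * I +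
          (∫ s in (-a)..a, h s * P₁ s) + ε * I * I := by
        have e1 : ∫ s in (-a)..a, (1 + ε) * h s ^ 2 = (1 + ε) * ∫ s in (-a)..a, h s ^ 2 :=
          intervalIntegral.integral_const_mul _ _
        have e2 : ∫ s in (-a)..a, (1 + ε) * L / (2 * lam) * h s = (1 + ε) * L / (2 * lam) * I :=
          intervalIntegral.integral_const_mul _ _
        have e4 : ∫ s in (-a)..a, ε * I * h s = ε * I * I :=
          intervalIntegral.integral_const_mul _ _
        rw [e1, e2, e4]
    _ = _ := by simp only [hP₁]; ring

/-! ## Polynomial bookkeeping for the test kernel `h(s) = 1 − s² + s⁴/6` -/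

/-- Derivative of a real polynomial of degree `≤ 11` written out in coefficients. [folklore] -/
theorem hasDerivAt_poly (c0 c1 c2 c3 c4 c5 c6 c7 c8 c9 c10 c11 x : ℝ) :
    HasDerivAt (fun x ↦ c0 + c1 * x + c2 * x ^ 2 + c3 * x ^ 3 + c4 * x ^ 4 + c5 * x ^ 5 +
        c6 * x ^ 6 + c7 * x ^ 7 + c8 * x ^ 8 + c9 * x ^ 9 + c10 * x ^ 10 + c11 * x ^ 11)
      (c1 + 2 * c2 * x + 3 * c3 * x ^ 2 + 4 * c4 * x ^ 3 + 5 * c5 * x ^ 4 + 6 * c6 * x ^ 5 +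
        7 * c7 * x ^ 6 + 8 * c8 * x ^ 7 + 9 * c9 * x ^ 8 + 10 * c10 * x ^ 9 + 11 * c11 * x ^ 10)
      x := by
  have hp : ∀ (n : ℕ) (c : ℝ), HasDerivAt (fun x ↦ c * x ^ n) (c * (n * x ^ (n - 1))) x :=
    fun n c ↦ (hasDerivAt_pow n x).const_mul c
  have h1 : HasDerivAt (fun x ↦ c1 * x) c1 x := by simpa using (hasDerivAt_id x).const_mul c1
  refine ((((((((((((hasDerivAt_const x c0).add h1).add (hp 2 c2)).add (hp 3 c3)).add
    (hp 4 c4)).add (hp 5 c5)).add (hp 6 c6)).add (hp 7 c7)).add (hp 8 c8)).add (hp 9 c9)).add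
    (hp 10 c10)).add (hp 11 c11)).congr_deriv ?_
  norm_num
  ring

/-- `∫_{-a}^{a} h = 2a − 2a³/3 + a⁵/15` for `h(s) = 1 − s² + s⁴/6`. [folklore] -/
theorem integral_kernelH (a : ℝ) :
    ∫ s in (-a)..a, (1 - s ^ 2 + s ^ 4 / 6) = 2 * a - 2 / 3 * a ^ 3 + 1 / 15 * a ^ 5 := by
  have := intervalIntegral.integral_eq_sub_of_hasDerivAt (a := -a) (b := a)
    (f' := fun s ↦ 1 - s ^ 2 + s ^ 4 / 6)
    (fun x _ ↦ (hasDerivAt_poly 0 1 0 (-1 / 3) 0 (1 / 30) 0 0 0 0 0 0 x).congr_deriv (by ring))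
    ((by fun_prop : Continuous fun s : ℝ ↦ 1 - s ^ 2 + s ^ 4 / 6).intervalIntegrable _ _)
  rw [this]
  ring

/-- `∫_{-a}^{a} h² = 2(a − 2a³/3 + 4a⁵/15 − a⁷/21 + a⁹/324)` for `h(s) = 1 − s² + s⁴/6`.
[folklore] -/
theorem integral_kernelH_sq (a : ℝ) :
    ∫ s in (-a)..a, (1 - s ^ 2 + s ^ 4 / 6) ^ 2 =
      2 * (a - 2 / 3 * a ^ 3 + 4 / 15 * a ^ 5 - 1 / 21 * a ^ 7 + 1 / 324 * a ^ 9) := by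
  have := intervalIntegral.integral_eq_sub_of_hasDerivAt (a := -a) (b := a)
    (f' := fun s ↦ (1 - s ^ 2 + s ^ 4 / 6) ^ 2)
    (fun x _ ↦ (hasDerivAt_poly 0 1 0 (-2 / 3) 0 (4 / 15) 0 (-1 / 21) 0 (1 / 324) 0 0 x).congr_deriv
      (by ring))
    ((by fun_prop : Continuous fun s : ℝ ↦ (1 - s ^ 2 + s ^ 4 / 6) ^ 2).intervalIntegrable _ _)
  rw [this]
  ring

/-- The first moment kernel `P₁(s) = ∫_{-a}^{a} h(t)|s − t| dt` in closed form on `[-a, a]`: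
`P₁(s) = s² − s⁴/6 + s⁶/90 + (a² − a⁴/2 + a⁶/18)` (split at `t = s`). [folklore] -/
theorem integral_kernelH_mul_abs {a s : ℝ} (h₁ : -a ≤ s) (h₂ : s ≤ a) :
    ∫ t in (-a)..a, (1 - t ^ 2 + t ^ 4 / 6) * |s - t| =
      s ^ 2 - s ^ 4 / 6 + s ^ 6 / 90 + (a ^ 2 - a ^ 4 / 2 + a ^ 6 / 18) := by
  have hc : Continuous fun t : ℝ ↦ (1 - t ^ 2 + t ^ 4 / 6) * |s - t| := by fun_prop
  rw [← intervalIntegral.integral_add_adjacent_intervals (b := s) (hc.intervalIntegrable _ _)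
    (hc.intervalIntegrable _ _)]
  -- on `[-a, s]`: `|s - t| = s - t`
  have e1 : ∫ t in (-a)..s, (1 - t ^ 2 + t ^ 4 / 6) * |s - t| =
      ∫ t in (-a)..s, (1 - t ^ 2 + t ^ 4 / 6) * (s - t) := by
    refine intervalIntegral.integral_congr fun t ht ↦ ?_
    rw [uIcc_of_le h₁] at ht
    simp [abs_of_nonneg (sub_nonneg.2 ht.2)]
  -- on `[s, a]`: `|s - t| = t - s`
  have e2 : ∫ t in s..a, (1 - t ^ 2 + t ^ 4 / 6) * |s - t| =
      ∫ t in s..a, (1 - t ^ 2 + t ^ 4 / 6) * (t - s) := by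
    refine intervalIntegral.integral_congr fun t ht ↦ ?_
    rw [uIcc_of_le h₂] at ht
    simp [abs_of_nonpos (sub_nonpos.2 ht.1)]
  have i1 := intervalIntegral.integral_eq_sub_of_hasDerivAt (a := -a) (b := s)
    (f' := fun t ↦ (1 - t ^ 2 + t ^ 4 / 6) * (s - t))
    (fun x _ ↦ (hasDerivAt_poly 0 s (-1 / 2) (-s / 3) (1 / 4) (s / 30) (-1 / 36) 0 0 0 0 0 x).congr_deriv
      (by ring))
    ((by fun_prop : Continuous fun t : ℝ ↦ (1 - t ^ 2 + t ^ 4 / 6) * (s - t)).intervalIntegrable _ _)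
  have i2 := intervalIntegral.integral_eq_sub_of_hasDerivAt (a := s) (b := a)
    (f' := fun t ↦ (1 - t ^ 2 + t ^ 4 / 6) * (t - s))
    (fun x _ ↦ (hasDerivAt_poly 0 (-s) (1 / 2) (s / 3) (-1 / 4) (-s / 30) (1 / 36) 0 0 0 0 0 x).congr_deriv
      (by ring))
    ((by fun_prop : Continuous fun t : ℝ ↦ (1 - t ^ 2 + t ^ 4 / 6) * (t - s)).intervalIntegrable _ _)
  rw [e1, e2, i1, i2]
  ring

/-- `M₁ = ∫_{-a}^{a} h(s) P₁(s) ds` in closed form, with `P₁` as in `integral_kernelH_mul_abs`.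
[folklore] -/
theorem integral_kernelH_mul_moment (a : ℝ) :
    ∫ s in (-a)..a, (1 - s ^ 2 + s ^ 4 / 6) *
        (s ^ 2 - s ^ 4 / 6 + s ^ 6 / 90 + (a ^ 2 - a ^ 4 / 2 + a ^ 6 / 18)) =
      2 * (a ^ 3 / 3 - 7 / 30 * a ^ 5 + 31 / 630 * a ^ 7 - 7 / 1620 * a ^ 9 + a ^ 11 / 5940) +
        (a ^ 2 - a ^ 4 / 2 + a ^ 6 / 18) * (2 * a - 2 / 3 * a ^ 3 + 1 / 15 * a ^ 5) := by
  set C := a ^ 2 - a ^ 4 / 2 + a ^ 6 / 18 with hC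
  have := intervalIntegral.integral_eq_sub_of_hasDerivAt (a := -a) (b := a)
    (f' := fun s ↦ (1 - s ^ 2 + s ^ 4 / 6) * (s ^ 2 - s ^ 4 / 6 + s ^ 6 / 90 + C))
    (fun x _ ↦ (hasDerivAt_poly 0 C 0 (1 / 3 - C / 3) 0 (-7 / 30 + C / 30) 0 (31 / 630) 0
      (-7 / 1620) 0 (1 / 5940) x).congr_deriv (by ring))
    ((by fun_prop : Continuous fun s : ℝ ↦
      (1 - s ^ 2 + s ^ 4 / 6) * (s ^ 2 - s ^ 4 / 6 + s ^ 6 / 90 + C)).intervalIntegrable _ _)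
  rw [this]
  ring

/-- On `[-a, a]` with `a ≤ 1/2` the kernel is non-negative: `1 − s² + s⁴/6 ≥ 3/4`. [folklore] -/
theorem kernelH_nonneg {a s : ℝ} (ha : a ≤ 1 / 2) (hs : s ∈ Icc (-a) a) :
    0 ≤ 1 - s ^ 2 + s ^ 4 / 6 := by
  have h1 : s ^ 2 ≤ 1 / 4 := by nlinarith [hs.1, hs.2]
  nlinarith [sq_nonneg (s ^ 2)]

/-- On `[-a, a]` with `a ≤ 1/2` the kernel is `1`-Lipschitz:
`h(t) − h(s) = (s − t)(s + t)(1 − (s² + t²)/6)` and `|s + t| ≤ 1`, `0 ≤ 1 − (s²+t²)/6 ≤ 1`.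
[folklore] -/
theorem kernelH_lipschitz {a s t : ℝ} (ha : a ≤ 1 / 2) (hs : s ∈ Icc (-a) a) (ht : t ∈ Icc (-a) a) :
    1 - t ^ 2 + t ^ 4 / 6 ≤ (1 - s ^ 2 + s ^ 4 / 6) + 1 * |s - t| := by
  have hM : |(s + t) * (1 - (s ^ 2 + t ^ 2) / 6)| ≤ 1 := by
    rw [abs_mul]
    refine mul_le_one₀ (abs_le.2 ⟨by linarith [hs.1, ht.1], by linarith [hs.2, ht.2]⟩)
      (abs_nonneg _) (abs_le.2 ⟨?_, ?_⟩)
    · nlinarith [hs.1, hs.2, ht.1, ht.2]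
    · nlinarith [sq_nonneg s, sq_nonneg t]
  have key : (1 - t ^ 2 + t ^ 4 / 6) - (1 - s ^ 2 + s ^ 4 / 6) ≤ |s - t| :=
    calc (1 - t ^ 2 + t ^ 4 / 6) - (1 - s ^ 2 + s ^ 4 / 6)
        = (s - t) * ((s + t) * (1 - (s ^ 2 + t ^ 2) / 6)) := by ring
      _ ≤ |(s - t) * ((s + t) * (1 - (s ^ 2 + t ^ 2) / 6))| := le_abs_self _
      _ = |s - t| * |(s + t) * (1 - (s ^ 2 + t ^ 2) / 6)| := abs_mul _ _
      _ ≤ |s - t| * 1 := by gcongr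
      _ = |s - t| := mul_one _
  linarith

/-! ## Assembly -/

/-- Montgomery's theorem (`montgomery_pair_correlation_restricted_holds`, with `δ = 1 − 2a`) in
the form consumed here: assuming RH, for `2a < 1` and `ε > 0`, for all large `T` and every
`|v| ≤ 2a`, `F(v, T) ≤ (1 + ε) log T · e^{−2 log T |v|} + |v| + ε` (`T^{−2|v|} log T` rewritten
with `T^x = e^{x log T}`). [cite: Montgomery1973, Theorem] -/
theorem eventually_formFactor_le (hRH : RiemannHypothesis) {a ε : ℝ} (ha2 : 2 * a < 1) (hε : 0 < ε) :
    ∀ᶠ T : ℝ in atTop, ∀ v : ℝ, |v| ≤ 2 * a →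
      montgomeryFormFactor v T ≤
        (1 + ε) * (Real.log T * Real.exp (-2 * Real.log T * |v|)) + |v| + ε := by
  have hδ : 0 < 1 - 2 * a := by linarith
  filter_upwards [montgomery_pair_correlation_restricted_holds hRH hδ hε,
    eventually_gt_atTop (1 : ℝ)] with T hM hT v hv
  have hT0 : (0 : ℝ) < T := by linarith
  have h1 := hM v (by linarith)
  have h2 : T ^ (-2 * |v|) * Real.log T = Real.log T * Real.exp (-2 * Real.log T * |v|) := by
    rw [Real.rpow_def_of_pos hT0, show Real.log T * (-2 * |v|) = -2 * Real.log T * |v| by ring,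
      mul_comm]
  rw [h2] at h1
  have := (abs_le.1 h1).2
  linarith

/-- **The Montgomery–Taylor inequality, before optimisation** (Cheer–Goldston 1993, (9)–(10) with
`r̂ = h * h̃`, `h ≥ 0` supported on `[−a, a]`, `2a < 1`): assuming RH, for every `ε > 0` and all
large `T`,
`(2π/(T log T)) (∫h)² · #{(n,n') : γ_n = γ_{n'}} ≤ (1+ε)(∫h² + L∫h/(2 log T)) + ∫_s h(s)∫_t h(t)|s−t| + ε(∫h)²`.
The left side dominates `(2π/(T log T)) (∫h)² ∑_ρ m(ρ)²`
(`SimpleZerosProofs.finsum_sq_order_le_card_diag`), so that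
`∑_ρ m(ρ)² ≤ ((∫h² + ∫∫ h(s)h(t)|s−t|)/(∫h)² + o(1)) (T/2π) log T`, which is (10):
`N*(T) ≤ (r̂(0) + 2∫_0^1 α r̂(α) dα)/r(0) + o(1)) TL`. [cite: CheerGoldston1993, §2 (10)] -/
theorem eventually_mul_card_diag_le (hRH : RiemannHypothesis) {a L ε : ℝ} (ha : 0 < a)
    (ha2 : 2 * a < 1) (hL : 0 ≤ L) (hε : 0 < ε) {h : ℝ → ℝ} (hh : Continuous h)
    (h0 : ∀ s ∈ Icc (-a) a, 0 ≤ h s)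
    (hLip : ∀ s ∈ Icc (-a) a, ∀ t ∈ Icc (-a) a, h t ≤ h s + L * |s - t|) :
    ∀ᶠ T : ℝ in atTop,
      2 * π / (T * Real.log T) * (∫ s in (-a)..a, h s) ^ 2 *
          (((zeroIndexSet T ×ˢ zeroIndexSet T).filter
            (fun p ↦ zetaOrdinate p.1 = zetaOrdinate p.2)).card : ℝ) ≤
        (1 + ε) * ((∫ s in (-a)..a, h s ^ 2) + L * (∫ s in (-a)..a, h s) / (2 * Real.log T)) +
          (∫ s in (-a)..a, h s * ∫ t in (-a)..a, h t * |s - t|) +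
            ε * (∫ s in (-a)..a, h s) ^ 2 := by
  filter_upwards [eventually_formFactor_le hRH ha2 hε, eventually_gt_atTop (1 : ℝ)] with T hF hT
  exact (mul_card_diag_le_integral_integral hT hh a).trans
    (integral_integral_le_of_formFactor_bound ha (Real.log_pos hT) hε.le hL hh
      (continuous_montgomeryFormFactor T) h0 hLip hF)

end CheerGoldston

open CheerGoldston in
/-- **DISCHARGE of `CheerGoldston1993_sum_multiplicity`** (Cheer–Goldston 1993, §2: the
Montgomery–Taylor bound `N*(T) = ∑_{0<γ≤T} m_ρ ≤ (1/2 + 2^{−1/2} cot(2^{−1/2}) + o(1)) TL =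
(1.3274993… + o(1)) TL` obtained from (10) with the optimal kernel (11)–(12), which already implies
the rounded constant `1.3275` quoted by Bui–Heath-Brown and recorded in the fact; the further
improvement `1.32724667` of §3 is not needed). PROVED from the tree's Montgomery theorem
`montgomery_pair_correlation_restricted_holds` and Riemann–von Mangoldt `riemann_von_mangoldt_holds`:
we run (8)–(10) with `r̂ = h * h̃` for the quartic `h(s) = 1 − s² + s⁴/6` (the Taylor polynomial of
the optimal `cos(√2 s)`) on `[−a, a]`, `a = 1/2 − 10⁻⁷` (so that `|α| ≤ 2a = 1 − δ` stays inside the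
uniform range of Montgomery's theorem), for which
`V = (∫h² + ∫∫h(s)h(t)|s−t|)/(∫h)² = 1.32749943… < 1.3275` is a rational number
(`integral_kernelH`, `integral_kernelH_sq`, `integral_kernelH_mul_abs`,
`integral_kernelH_mul_moment`); with `∑_ρ m(ρ)² ≤ #{γ_n = γ_{n'}}`
(`SimpleZerosProofs.finsum_sq_order_le_card_diag`), `eventually_mul_card_diag_le` (`ε = 10⁻⁷`) and
`T log T/(2π) ≤ (1 + 10⁻⁷) N(T)` (`ZeroGapsProofs.eventually_mul_log_le`) this gives
`∑_ρ m(ρ)² ≤ 1.3275 N(T)` for all large `T`.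
[cite: CheerGoldston1993, §2 (10)–(12) and §3, p. 371] -/
theorem CheerGoldston1993_sum_multiplicity_holds : CheerGoldston1993_sum_multiplicity := by
  intro hRH ε hε
  set a : ℝ := 4999999 / 10000000 with ha
  have ha0 : 0 < a := by norm_num [ha]
  have ha2 : 2 * a < 1 := by norm_num [ha]
  have ha12 : a ≤ 1 / 2 := by norm_num [ha]
  have hh : Continuous fun s : ℝ ↦ 1 - s ^ 2 + s ^ 4 / 6 := by fun_prop
  have hmain := eventually_mul_card_diag_le hRH ha0 ha2 zero_le_one
    (by norm_num : (0 : ℝ) < 1 / 10 ^ 7) hh (fun s hs ↦ kernelH_nonneg ha12 hs)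
    (fun s hs t ht ↦ kernelH_lipschitz ha12 hs ht)
  have hN := ZeroGapsProofs.eventually_mul_log_le (ε := 1 / 10 ^ 7) (by norm_num)
  have hlog : ∀ᶠ T : ℝ in atTop, (10 : ℝ) ^ 7 ≤ Real.log T :=
    Real.tendsto_log_atTop.eventually_ge_atTop _
  filter_upwards [hmain, hN, hlog, eventually_gt_atTop (1 : ℝ)] with T h1 h2 h3 hT
  -- closed forms of the four kernel integrals
  have eP : ∫ s in (-a)..a, (1 - s ^ 2 + s ^ 4 / 6) *
      ∫ t in (-a)..a, (1 - t ^ 2 + t ^ 4 / 6) * |s - t| =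
      ∫ s in (-a)..a, (1 - s ^ 2 + s ^ 4 / 6) *
        (s ^ 2 - s ^ 4 / 6 + s ^ 6 / 90 + (a ^ 2 - a ^ 4 / 2 + a ^ 6 / 18)) := by
    refine intervalIntegral.integral_congr fun s hs ↦ ?_
    rw [uIcc_of_le (by linarith)] at hs
    simp only [integral_kernelH_mul_abs hs.1 hs.2]
  rw [integral_kernelH, integral_kernelH_sq, eP, integral_kernelH_mul_moment] at h1
  set ℓ := Real.log T with hℓ
  have hℓ0 : 0 < ℓ := by linarith
  have hT0 : 0 < T := by linarith
  set Dn : ℕ := ((zeroIndexSet T ×ˢ zeroIndexSet T).filter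
    (fun p ↦ zetaOrdinate p.1 = zetaOrdinate p.2)).card with hDn
  set Nr : ℝ := (zetaZeroCount T : ℝ) with hNr
  have hNr0 : 0 ≤ Nr := Nat.cast_nonneg _
  set I : ℝ := 2 * a - 2 / 3 * a ^ 3 + 1 / 15 * a ^ 5 with hI
  set M0 : ℝ := 2 * (a - 2 / 3 * a ^ 3 + 4 / 15 * a ^ 5 - 1 / 21 * a ^ 7 + 1 / 324 * a ^ 9) with hM0
  set M1 : ℝ := 2 * (a ^ 3 / 3 - 7 / 30 * a ^ 5 + 31 / 630 * a ^ 7 - 7 / 1620 * a ^ 9 + a ^ 11 / 5940) +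
    (a ^ 2 - a ^ 4 / 2 + a ^ 6 / 18) * (2 * a - 2 / 3 * a ^ 3 + 1 / 15 * a ^ 5) with hM1
  have hIpos : 0 < I := by norm_num [hI, ha]
  have hM00 : 0 ≤ M0 := by norm_num [hM0, ha]
  have hM10 : 0 ≤ M1 := by norm_num [hM1, ha]
  set B : ℝ := (1 + 1 / 10 ^ 7) * (M0 + 1 * I / (2 * ℓ)) + M1 + 1 / 10 ^ 7 * I ^ 2 with hB
  set B₀ : ℝ := (1 + 1 / 10 ^ 7) * (M0 + 1 * I / (2 * 10 ^ 7)) + M1 + 1 / 10 ^ 7 * I ^ 2 with hB₀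
  have hX0 : 0 ≤ 1 * I / (2 * ℓ) := by positivity
  have hBB₀ : B ≤ B₀ := by
    have : 1 * I / (2 * ℓ) ≤ 1 * I / (2 * 10 ^ 7) :=
      div_le_div_of_nonneg_left (by positivity) (by positivity) (by linarith)
    simp only [hB, hB₀]
    linarith
  have hB0 : 0 ≤ B := by
    have := sq_nonneg I
    simp only [hB]
    positivity
  have hcert : (1 + 1 / 10 ^ 7) * B₀ ≤ 1.3275 * I ^ 2 := by
    norm_num [hB₀, hI, hM0, hM1, ha]
  -- from `h1`: `2π I² Dn ≤ B · T ℓ`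
  have h1' : 2 * π * I ^ 2 * (Dn : ℝ) ≤ B * (T * ℓ) := by
    have e : 2 * π / (T * ℓ) * I ^ 2 * (Dn : ℝ) = 2 * π * I ^ 2 * (Dn : ℝ) / (T * ℓ) := by ring
    rw [e, div_le_iff₀ (by positivity)] at h1
    exact h1
  -- from `h2`: `T ℓ ≤ 2π (1 + η) N(T)`
  have h2' : T * ℓ ≤ 2 * π * ((1 + 1 / 10 ^ 7) * Nr) := by
    rw [show T / (2 * π) * ℓ = T * ℓ / (2 * π) by ring, div_le_iff₀ (by positivity)] at h2
    linarith
  have h4 : 2 * π * (I ^ 2 * Dn) ≤ 2 * π * ((1 + 1 / 10 ^ 7) * B₀ * Nr) :=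
    calc 2 * π * (I ^ 2 * Dn) = 2 * π * I ^ 2 * (Dn : ℝ) := by ring
      _ ≤ B * (T * ℓ) := h1'
      _ ≤ B * (2 * π * ((1 + 1 / 10 ^ 7) * Nr)) := mul_le_mul_of_nonneg_left h2' hB0
      _ ≤ B₀ * (2 * π * ((1 + 1 / 10 ^ 7) * Nr)) := mul_le_mul_of_nonneg_right hBB₀ (by positivity)
      _ = 2 * π * ((1 + 1 / 10 ^ 7) * B₀ * Nr) := by ring
  have h5 : I ^ 2 * Dn ≤ (1 + 1 / 10 ^ 7) * B₀ * Nr := le_of_mul_le_mul_left h4 (by positivity)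
  have h6 : I ^ 2 * Dn ≤ I ^ 2 * (1.3275 * Nr) :=
    h5.trans ((mul_le_mul_of_nonneg_right hcert hNr0).trans_eq (by ring))
  have h7 : (Dn : ℝ) ≤ 1.3275 * Nr := le_of_mul_le_mul_left h6 (by positivity)
  -- multiplicities versus the diagonal, and the conclusion
  have hD : ((∑ᶠ ρ ∈ zetaZeroBox 0 T, riemannZetaZeroOrder ρ ^ 2 : ℤ) : ℝ) ≤ (Dn : ℝ) := by
    exact_mod_cast SimpleZerosProofs.finsum_sq_order_le_card_diag T
  calc ((∑ᶠ ρ ∈ zetaZeroBox 0 T, riemannZetaZeroOrder ρ ^ 2 : ℤ) : ℝ) ≤ Dn := hD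
    _ ≤ 1.3275 * Nr := h7
    _ ≤ (1.3275 + ε) * Nr := by linarith [mul_nonneg hε.le hNr0]

/-! ## Consequence: Bui–Heath-Brown's Corollary 1 depends on their Theorem 1 alone

Bui–Heath-Brown 2013, §1, deduce Corollary 1 (`κ_d ≥ 0.84665` on RH, the named fact
`BuiHeathbrown2013_distinct_zeros`) from Theorem 1 (`κ* ≥ 19/27` on RH, the named fact
`BuiHeathbrown2013_simple_zeros`), Montgomery's counting observation and the Cheer–Goldston bound;
that deduction is `BuiHeathbrown2013_distinct_zeros_of_simple_zeros` (`SimpleZeros.lean`, proved).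
With `CheerGoldston1993_sum_multiplicity_holds` above, Theorem 1 is the only input of Corollary 1
not proved in the tree: the discharge `BuiHeathbrown2013_distinct_zeros_holds` is the theorem below
applied to a proof of `BuiHeathbrown2013_simple_zeros`. -/

/-- **Corollary 1 from Theorem 1 alone** (Bui–Heath-Brown 2013, §1: "The corollary is a
consequence of our theorem following an observation of Montgomery … Cheer and Goldston also showed
that `∑_{0<γ≤T} m(ρ) ≤ (1.3275 + o(1)) N(T)`. Hence `κ_d ≥ (5 + 2κ* − 1.3275)/6 ≥ 0.84665`"),
PROVED: the printed deduction `BuiHeathbrown2013_distinct_zeros_of_simple_zeros` with its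
Cheer–Goldston hypothesis discharged by `CheerGoldston1993_sum_multiplicity_holds`.
[cite: BuiHeathbrown2013, §1, Corollary 1] -/
theorem BuiHeathbrown2013_simple_zeros.distinct_zeros (h : BuiHeathbrown2013_simple_zeros) :
    BuiHeathbrown2013_distinct_zeros :=
  BuiHeathbrown2013_distinct_zeros_of_simple_zeros h CheerGoldston1993_sum_multiplicity_holds

end Literature.NumberTheory.LFunctions
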